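import Literature.AlgebraicGeometry.Motives.StandardConjectures
import Literature.AlgebraicGeometry.Motives.CorrespondencesKunneth
import Literature.AlgebraicGeometry.Motives.LefschetzStarProofs
import Literature.AlgebraicGeometry.Motives.WeilCohomologyProofs
import Literature.AlgebraicGeometry.Motives.MotivatedCyclesProofs
import Mathlib.LinearAlgebra.FiniteDimensional.Basic
import Mathlib.Algebra.Ring.Int.Units
import HarnessLib

/-!
# Standard conjectures: `B ∧ Hdg ⇒ D`, and the reduction of hodge.S29 (`D ⇔ B` given `Hdg`)

Proofs towards the named fact
`Literature.AlgebraicGeometry.Motives.standardConjectureD_iff_standardConjectureB_of_hodgeStandardConjecture`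
of `StandardConjectures` (Grothendieck 1968 §4: "in characteristic zero `B` and `D` are
equivalent"; Kleiman 1968 §3; Kleiman 1994 §5): under hard Lefschetz and the Hodge standard
conjecture for `W`, `D` holds for every smooth projective `X` iff `B` holds for every `(X, η)`.

## What is proved here (all formal in the axioms of `WeilCohomology`, no new named facts)

* `standardConjectureD_of_standardConjectureB_of_standardConjectureHdg_self`:
  **`B(X, η) ∧ Hdg(X, η) ⇒ D(X)`** for a single smooth projective `X` with hyperplane class `η`
  (Kleiman 1968 §3; Murre 2004 §4.2.1.4 (1) "`B(X) + Hdg(X) ⇒ D(X)`, i.e. homological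
  equivalence = numerical equivalence"). Printed proof: `B(X)` gives `A(X, L)` (the algebraic
  inverse `θ` of `Lⁿ⁻²ᵖ` maps algebraic classes to algebraic classes, axiom
  `map_ratAlgebraicClasses_of_isInducedBy`), hence every algebraic class `x ∈ Aᵖ(X)_ℚ`,
  `2p ≤ n`, splits as `x = x₀ + L x'` with `x₀ ∈ Aᵖ(X)_ℚ` primitive and `x' ∈ Aᵖ⁻¹(X)_ℚ`; if
  `x` is numerically trivial then `⟨x₀, Lⁿ⁻²ᵖ x₀⟩ = ⟨x, Lⁿ⁻²ᵖ x₀⟩ = 0`, so `x₀ = 0` by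
  `Hdg(X, η)`, and `x'` is again orthogonal to `Lⁿ⁻²ᵖ⁺² Aᵖ⁻¹(X)_ℚ`; induction on `p`
  (`eq_zero_of_cupPairing_lefschetzPow_eq_zero`). For `2p > n` one writes `x = Lᵖ⁻ᵠ x'` with
  `x'` algebraic (again by `θ`) and reduces to the previous case. Ingredients: the hyperplane
  class and its powers are rational algebraic classes
  (`mem_ratAlgebraicClasses_of_isHyperplaneClass`, `pow_succ_mem_ratAlgebraicClasses` of
  `MotivatedCyclesProofs`, from `isSmoothProjective_projectiveSpace_holds`,
  `pullback_ratAlgebraicClasses_le`, `cup_mem_ratAlgebraicClasses`), and `L` is self-adjoint for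
  the cup-product pairing (`cupPairing_lefschetzPow_left`, from `cup_assoc`, `cup_comm`).
* `standardConjectureD_of_isSmoothProjective_zero`: `D(X)` for `X` of dimension `0`
  (`H⁰(X) = K · 1` and `tr (1 ∪ 1) ≠ 0`).
* `homNumStandardConjecture_of_lefschetzStandardConjecture`: for a Weil cohomology theory
  satisfying the Hodge standard conjecture, `B` (for all `(X, η)`) implies `D` (for all `X`) —
  one half of hodge.S29.
* `standardConjectureD_iff_standardConjectureB_of_hodgeStandardConjecture_of`: the named fact
  follows from the other half, Kleiman's theorem `D(X × X) ⇒ B(X)` (Kleiman 1968 Thm 2.9 with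
  §3), which is the (undischarged) named fact `standardConjectureB_of_standardConjectureD_tensor`
  of `StandardConjectures`, taken here as the explicit hypothesis `hDB`; `X × X` is smooth
  projective by the discharged fact `IsSmoothProjective.tensor` (`isSmoothProjective_tensor`).

Nothing of `StandardConjectures.lean` is restated or modified; the discharge
`standardConjectureD_iff_standardConjectureB_of_hodgeStandardConjecture_holds` is exactly
`…_of standardConjectureB_of_standardConjectureD_tensor_holds` once the latter exists.

## References

* S. Kleiman, *Algebraic cycles and the Weil conjectures*, in: Dix exposés sur la cohomologie
  des schémas, North-Holland (1968), 359–386, §2 (Thm 2.9), §3.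
* S. Kleiman, *The standard conjectures*, Proc. Sympos. Pure Math. 55 Part 1 (1994), 3–20, §5.
* J. P. Murre, *Lectures on motives*, in: Transcendental Aspects of Algebraic Cycles, LMS
  Lecture Note Ser. 313 (2004), §4.2.1.2 (b) (`B(X) ⇒ A(X, L)`), §4.2.1.4 (1)
  (`B(X) + Hdg(X) ⇒ D(X)`).
* A. Grothendieck, *Standard conjectures on algebraic cycles* (Bombay 1968), §4.
-/

universe u v

open CategoryTheory AlgebraicGeometry MonoidalCategory CartesianMonoidalCategory
open scoped TensorProduct

noncomputable section

namespace Literature.AlgebraicGeometry.Motives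

namespace WeilCohomology

variable {k : Type u} [Field k] {K : Type v} [Field K] [CharZero K] (W : WeilCohomology k K)
variable {n : ℕ} {X : SchemeOver k} {η : W.obj X 2}

/-! ## Degree bookkeeping -/

/-- The vanishing of `Lʳ x` does not depend on the name of the target degree. [folklore] -/
theorem lefschetzPow_eq_zero_iff_of_eq (η : W.obj X 2) {i r j₁ j₂ : ℕ} (h₁ : i + 2 * r = j₁)
    (h₂ : i + 2 * r = j₂) (x : W.obj X i) :
    W.lefschetzPow X η r i j₁ h₁ x = 0 ↔ W.lefschetzPow X η r i j₂ h₂ x = 0 := by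
  subst h₁; subst h₂; rfl

/-- The value `⟨x, Lʳ x'⟩` does not depend on the name of the target degree. [folklore] -/
theorem cupPairing_lefschetzPow_congr (η : W.obj X 2) {i r j₁ j₂ : ℕ} (h₁ : i + 2 * r = j₁)
    (h₂ : i + 2 * r = j₂) (h₁' : i + j₁ = 2 * n) (h₂' : i + j₂ = 2 * n) (x x' : W.obj X i) :
    W.cupPairing X n i j₁ h₁' x (W.lefschetzPow X η r i j₁ h₁ x') =
      W.cupPairing X n i j₂ h₂' x (W.lefschetzPow X η r i j₂ h₂ x') := by
  subst h₁; subst h₂; rfl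

/-! ## The Lefschetz operator is self-adjoint and algebraic -/

/-- **`L` is self-adjoint** for the cup-product pairing: `⟨Lᵃ u, v⟩ = ⟨u, Lᵃ v⟩`, i.e.
`tr ((u ∪ ηᵃ) ∪ v) = tr (u ∪ (v ∪ ηᵃ))` (`cup_assoc`, `cup_comm` with even degree `2a`;
Kleiman 1968 §1.4). [cite: Kleiman1968AlgebraicCycles, §1.4] -/
theorem cupPairing_lefschetzPow_left (hX : IsSmoothProjective n X) (η : W.obj X 2)
    {a i j m m' : ℕ} (h₁ : i + 2 * a = j) (h₂ : j + m = 2 * n) (h₃ : m + 2 * a = m')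
    (h₄ : i + m' = 2 * n) (u : W.obj X i) (v : W.obj X m) :
    W.cupPairing X n j m h₂ (W.lefschetzPow X η a i j h₁ u) v =
      W.cupPairing X n i m' h₄ u (W.lefschetzPow X η a m m' h₃ v) := by
  simp only [cupPairing_apply, PreWeilCohomology.lefschetzPow, LinearMap.flip_apply]
  rw [W.cup_assoc hX h₁ (show 2 * a + m = m' by omega) h₂ h₄ u (W.pow X η a) v,
    W.cup_comm_of_even hX (show 2 * a + m = m' by omega) h₃ (Or.inl ⟨a, two_mul a⟩)
      (W.pow X η a) v]

/-- The cup-product pairing is symmetric when one of the degrees is even: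
`⟨a, b⟩ = ⟨b, a⟩` (`cup_comm`, sign `+1`). [folklore] -/
theorem cupPairing_comm_of_even (hX : IsSmoothProjective n X) {i j : ℕ} (h : i + j = 2 * n)
    (h' : j + i = 2 * n) (he : Even i ∨ Even j) (a : W.obj X i) (b : W.obj X j) :
    W.cupPairing X n i j h a b = W.cupPairing X n j i h' b a := by
  simp only [cupPairing_apply]
  rw [W.cup_comm_of_even hX h h' he a b]

/-- **`L` preserves algebraic classes**: `Lˢ (Aᵖ(X)_ℚ) ⊆ Aᵖ⁺ˢ(X)_ℚ` for a hyperplane class `η`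
(Kleiman 1968 §1.4; Murre 2004 §4.2.1.2 (b), the bottom arrow of the diagram `A(X, L)`).
[cite: Kleiman1968AlgebraicCycles, §1.4] -/
theorem lefschetzPow_mem_ratAlgebraicClasses (hX : IsSmoothProjective n X)
    (hη : W.IsHyperplaneClass X η) {p s q : ℕ} (hq : p + s = q) (h : 2 * p + 2 * s = 2 * q)
    {x : W.obj X (2 * p)} (hx : x ∈ W.ratAlgebraicClasses X p) :
    W.lefschetzPow X η s (2 * p) (2 * q) h x ∈ W.ratAlgebraicClasses X q := by
  subst hq
  cases s with
  | zero =>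
    have h0 : W.lefschetzPow X η 0 (2 * p) (2 * (p + 0)) h x = x :=
      W.lefschetzPow_zero_apply hX η _ x
    rw [h0]
    exact hx
  | succ s =>
    exact W.cup_mem_ratAlgebraicClasses hX rfl x _ hx
      (W.pow_succ_mem_ratAlgebraicClasses hX
        (W.mem_ratAlgebraicClasses_of_isHyperplaneClass hX hη) s)

/-- **`B(X) ⇒ A(X, L)`**, in the form used below (Kleiman 1968 §2; Murre 2004 §4.2.1.2 (b)):
under `B(X, η)`, for `2p + r = n` and `p + r = q` the hard-Lefschetz map
`Lʳ : H²ᵖ(X) → H²ᵠ(X)` has a two-sided inverse `θ` mapping `Aᵠ(X)_ℚ` into `Aᵖ(X)_ℚ`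
(the algebraic correspondence inducing `θ` preserves rational algebraic classes, axiom
`map_ratAlgebraicClasses_of_isInducedBy`). [cite: Murre2004LecturesMotives, §4.2.1.2 (b)] -/
theorem exists_theta_map_ratAlgebraicClasses (hX : IsSmoothProjective n X)
    (hB : W.StandardConjectureB n X η) {p r q : ℕ} (hr : 2 * p + r = n) (hq : p + r = q) :
    ∃ θ : W.obj X (2 * q) →ₗ[K] W.obj X (2 * p),
      W.lefschetzPow X η r (2 * p) (2 * q) (by omega) ∘ₗ θ = LinearMap.id ∧
      θ ∘ₗ W.lefschetzPow X η r (2 * p) (2 * q) (by omega) = LinearMap.id ∧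
      ∀ y ∈ W.ratAlgebraicClasses X q, θ y ∈ W.ratAlgebraicClasses X p := by
  obtain ⟨θ, ⟨-, h₁, h₂⟩, u, hu, -⟩ := hB (2 * p) r (2 * q) hr (by omega)
  refine ⟨θ, h₂, h₁, fun y hy ↦ ?_⟩
  have hind := hu (2 * q) (2 * p) (2 * p) (2 * q) (by omega) (by omega) (by omega)
  rw [PreWeilCohomology.GradedOp.ofLinearMap_apply_same] at hind
  exact W.map_ratAlgebraicClasses_of_isInducedBy hX hX _ θ _ _ (u (2 * p)).2 hind y hy

/-! ## `B(X) ∧ Hdg(X) ⇒ D(X)` -/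

/-- A sign times a positive rational is a nonzero scalar of `K` (`char K = 0`). [folklore] -/
theorem negOnePow_smul_ratCast_ne_zero (p : ℤ) {c : ℚ} (hc : 0 < c) :
    ((p.negOnePow : ℤˣ) : ℤ) • (c : K) ≠ 0 := by
  have hc' : (c : K) ≠ 0 := by exact_mod_cast hc.ne'
  rcases Int.units_eq_one_or p.negOnePow with h | h <;> simp [h, hc']

/-- **Anisotropy of `x ↦ ⟨x, Lʳ x⟩` on algebraic classes** (the inductive core of
`B(X) + Hdg(X) ⇒ D(X)`, Kleiman 1968 §3; Murre 2004 §4.2.1.4 (1)): under `B(X, η)` and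
`Hdg(X, η)`, for `2p + r = n` (`p + r = q`), an algebraic class `x ∈ Aᵖ(X)_ℚ` with
`⟨x, Lʳ x'⟩ = 0` for all `x' ∈ Aᵖ(X)_ℚ` vanishes. Proof by induction on `p`: write
`x = x₀ + L x'` with `x₀` primitive algebraic and `x'` algebraic (`θ` of `B(X, η)`); then
`⟨x₀, Lʳ x₀⟩ = ⟨x, Lʳ x₀⟩ = 0` forces `x₀ = 0` by `Hdg(X, η)`, and `x'` satisfies the
hypothesis in degree `p - 1` because `⟨x', Lʳ⁺² x''⟩ = ⟨L x', Lʳ (L x'')⟩`.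
[cite: Murre2004LecturesMotives, §4.2.1.4 (1)] -/
theorem eq_zero_of_cupPairing_lefschetzPow_eq_zero (hX : IsSmoothProjective n X)
    (hη : W.IsHyperplaneClass X η) (hB : W.StandardConjectureB n X η)
    (hHdg : W.StandardConjectureHdg n X η) (p : ℕ) :
    ∀ {r q : ℕ} (_ : 2 * p + r = n) (_ : p + r = q) {x : W.obj X (2 * p)},
      x ∈ W.ratAlgebraicClasses X p →
      (∀ x' ∈ W.ratAlgebraicClasses X p,
        W.cupPairing X n (2 * p) (2 * q) (by omega) x
          (W.lefschetzPow X η r (2 * p) (2 * q) (by omega) x') = 0) →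
      x = 0 := by
  induction p with
  | zero =>
    intro r q hr hq x hx h0
    by_contra hx0
    obtain ⟨c, hc, hcx⟩ := hHdg 0 r hr x hx hx0 (W.eq_zero_of_lt hX (by omega) _)
    have h1 := h0 x hx
    rw [W.cupPairing_lefschetzPow_congr η (by omega) rfl (by omega) (by omega) x x, hcx] at h1
    exact negOnePow_smul_ratCast_ne_zero _ hc h1
  | succ p ih =>
    intro r q hr hq x hx h0
    -- the algebraic inverse `θ` of `Lʳ⁺² : H²ᵖ → H²⁽ᵠ⁺¹⁾`
    obtain ⟨θ, hθ₁, -, hθalg⟩ :=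
      W.exists_theta_map_ratAlgebraicClasses hX hB (p := p) (r := r + 2) (q := q + 1)
        (by omega) (by omega)
    -- `x = x₀ + L x'` with `x' = θ (Lʳ⁺¹ x)` algebraic and `x₀` primitive algebraic
    set y := W.lefschetzPow X η (r + 1) (2 * (p + 1)) (2 * (q + 1)) (by omega) x with hy
    have hyalg : y ∈ W.ratAlgebraicClasses X (q + 1) :=
      W.lefschetzPow_mem_ratAlgebraicClasses hX hη (by omega) _ hx
    set x' := θ y with hx'
    have hx'alg : x' ∈ W.ratAlgebraicClasses X p := hθalg y hyalg
    have hLx'alg : W.lefschetzPow X η 1 (2 * p) (2 * (p + 1)) (by omega) x' ∈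
        W.ratAlgebraicClasses X (p + 1) :=
      W.lefschetzPow_mem_ratAlgebraicClasses hX hη rfl _ hx'alg
    set x₀ := x - W.lefschetzPow X η 1 (2 * p) (2 * (p + 1)) (by omega) x' with hx₀
    have hx₀alg : x₀ ∈ W.ratAlgebraicClasses X (p + 1) := sub_mem hx hLx'alg
    have hprim : W.lefschetzPow X η (r + 1) (2 * (p + 1)) (2 * (q + 1)) (by omega) x₀ = 0 := by
      rw [hx₀, map_sub, ← hy, W.lefschetzPow_lefschetzPow hX η (show 1 + (r + 1) = r + 2 by omega)
        _ _ (show 2 * p + 2 * (r + 2) = 2 * (q + 1) by omega) x']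
      have := LinearMap.congr_fun hθ₁ y
      rw [LinearMap.comp_apply, LinearMap.id_apply] at this
      rw [this, sub_self]
    -- `L` moved across the pairing: `⟨L u, Lʳ v⟩ = ⟨u, Lʳ⁺¹ v⟩` for `u ∈ H²ᵖ`, `v ∈ H²ᵖ⁺²`
    have hadj : ∀ (u : W.obj X (2 * p)) (v : W.obj X (2 * (p + 1))),
        W.cupPairing X n (2 * (p + 1)) (2 * q) (by omega)
            (W.lefschetzPow X η 1 (2 * p) (2 * (p + 1)) (by omega) u)
            (W.lefschetzPow X η r (2 * (p + 1)) (2 * q) (by omega) v) =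
          W.cupPairing X n (2 * p) (2 * (q + 1)) (by omega) u
            (W.lefschetzPow X η (r + 1) (2 * (p + 1)) (2 * (q + 1)) (by omega) v) := by
      intro u v
      rw [W.cupPairing_lefschetzPow_left hX η (by omega) (by omega)
          (show 2 * q + 2 * 1 = 2 * (q + 1) by omega) (by omega) u,
        W.lefschetzPow_lefschetzPow hX η (show r + 1 = r + 1 from rfl)]
    -- `x₀ = 0` by the Hodge standard conjecture
    have hx₀0 : x₀ = 0 := by
      by_contra hne
      have hprim' := (W.lefschetzPow_eq_zero_iff_of_eq η (by omega)
        (rfl : 2 * (p + 1) + 2 * (r + 1) = 2 * (p + 1) + 2 * (r + 1)) x₀).mp hprim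
      obtain ⟨c, hc, hcx⟩ := hHdg (p + 1) r hr x₀ hx₀alg hne hprim'
      have h1 := h0 x₀ hx₀alg
      have hxsplit : x = x₀ + W.lefschetzPow X η 1 (2 * p) (2 * (p + 1)) (by omega) x' := by
        rw [hx₀, sub_add_cancel]
      rw [hxsplit, LinearMap.map_add₂, hadj x' x₀, hprim, map_zero, add_zero,
        W.cupPairing_lefschetzPow_congr η (by omega) rfl (by omega) (by omega) x₀ x₀, hcx] at h1
      exact negOnePow_smul_ratCast_ne_zero _ hc h1
    -- hence `x = L x'`, and `x'` satisfies the hypothesis in degree `p`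
    have hxL : x = W.lefschetzPow X η 1 (2 * p) (2 * (p + 1)) (by omega) x' := by
      rw [← sub_eq_zero]; exact hx₀0
    have hx'0 : x' = 0 := by
      refine ih (r := r + 2) (q := q + 1) (by omega) (by omega) hx'alg fun x'' hx'' ↦ ?_
      have h1 := h0 _ (W.lefschetzPow_mem_ratAlgebraicClasses hX hη rfl
        (show 2 * p + 2 * 1 = 2 * (p + 1) by omega) hx'')
      rw [hxL, hadj x' _, W.lefschetzPow_lefschetzPow hX η (show 1 + (r + 1) = r + 2 by omega)]
        at h1
      exact h1
    rw [hxL, hx'0, map_zero]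

/-- **`B(X) ∧ Hdg(X) ⇒ D(X)`** (Kleiman 1968 §3; Kleiman 1994 §5; Murre 2004 §4.2.1.4 (1):
"`B(X) + Hdg(X) ⇒ D(X)`, i.e. homological equivalence = numerical equivalence"). For `X`
smooth projective of dimension `n` with hyperplane class `η`, the `θ`-form of `B(X, η)` and
the Hodge standard conjecture `Hdg(X, η)` imply `D(X)`: a numerically trivial rational
algebraic class is zero. For `2p ≤ n` this is `eq_zero_of_cupPairing_lefschetzPow_eq_zero`
(testing against `Lʳ Aᵖ(X)_ℚ ⊆ Aⁿ⁻ᵖ(X)_ℚ`); for `2p > n`, `x = Lᵖ⁻ᵠ (θ x)` with `θ x`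
algebraic and numerically trivial in the previous sense (`L` is self-adjoint).
No separate hard Lefschetz hypothesis is needed (the `θ`-form of `B(X, η)` contains it).
[cite: Murre2004LecturesMotives, §4.2.1.4 (1)] -/
theorem standardConjectureD_of_standardConjectureB_of_standardConjectureHdg_self
    (hX : IsSmoothProjective n X) (hη : W.IsHyperplaneClass X η)
    (hB : W.StandardConjectureB n X η) (hHdg : W.StandardConjectureHdg n X η) :
    W.StandardConjectureD n X := by
  intro p q hpq x hx hnum
  rcases le_or_gt p q with hle | hlt
  · obtain ⟨r, rfl⟩ := Nat.exists_eq_add_of_le hle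
    exact W.eq_zero_of_cupPairing_lefschetzPow_eq_zero hX hη hB hHdg p (r := r) (q := p + r)
      (by omega) rfl hx
      fun x' hx' ↦ hnum _ (W.lefschetzPow_mem_ratAlgebraicClasses hX hη rfl _ hx')
  · obtain ⟨s, rfl⟩ := Nat.exists_eq_add_of_le hlt.le
    obtain ⟨θ, hθ₁, -, hθalg⟩ :=
      W.exists_theta_map_ratAlgebraicClasses hX hB (p := q) (r := s) (q := q + s) (by omega) rfl
    have hxL : x = W.lefschetzPow X η s (2 * q) (2 * (q + s)) (by omega) (θ x) := by
      have := LinearMap.congr_fun hθ₁ x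
      rw [LinearMap.comp_apply, LinearMap.id_apply] at this
      exact this.symm
    have hθx : θ x = 0 := by
      refine W.eq_zero_of_cupPairing_lefschetzPow_eq_zero hX hη hB hHdg q (r := s) (q := q + s)
        (by omega) rfl (hθalg x hx) fun x' hx' ↦ ?_
      rw [← W.cupPairing_lefschetzPow_left hX η (a := s) (j := 2 * (q + s)) (m' := 2 * (q + s))
          (by omega) (by omega) (by omega) (by omega) (θ x) x',
        ← hxL]
      exact hnum x' hx'
    rw [hxL, hθx, map_zero]

/-! ## Dimension zero, and the universal statements -/

/-- On a smooth projective `X` of dimension `0`, a class `x ∈ H⁰(X)` with `tr (x ∪ x) = 0`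
vanishes: `H⁰(X) = K · 1` (`finrank_obj_zero`, `one_cup`), `x = c · 1`, and
`tr (x ∪ x) = c² tr 1` with `tr 1 ≠ 0` (`bijective_trace`). [folklore] -/
theorem eq_zero_of_trace_cup_self_eq_zero (hX : IsSmoothProjective 0 X) (x : W.obj X 0)
    (h : W.trace X 0 (W.cup (zero_add 0) x x) = 0) : x = 0 := by
  have hone : (W.one X : W.obj X 0) ≠ 0 := by
    intro h1
    have hall : ∀ a : W.obj X 0, a = 0 := fun a ↦ by
      rw [← W.one_cup hX (zero_add 0) a, h1, LinearMap.map_zero₂]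
    haveI : Subsingleton (W.obj X 0) := ⟨fun a b ↦ by rw [hall a, hall b]⟩
    have hfr := W.finrank_obj_zero hX
    rw [Module.finrank_zero_of_subsingleton] at hfr
    exact zero_ne_one hfr
  haveI := W.finite_obj hX 0
  obtain ⟨c, rfl⟩ := (finrank_eq_one_iff_of_nonzero' (W.one X) hone).mp (W.finrank_obj_zero hX) x
  have htr : W.trace X 0 (W.one X) ≠ 0 := fun h0 ↦
    hone ((W.bijective_trace hX).1 (h0.trans (map_zero _).symm))
  have h1 : W.cup (zero_add 0) (W.one X) (W.one X) = W.one X := W.one_cup hX (zero_add 0) _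
  simp only [map_smul, LinearMap.smul_apply, h1, smul_eq_zero, htr, or_false, or_self] at h
  rw [h, zero_smul]

/-- **`D(X)` in dimension `0`**: for `X` smooth projective of dimension `0`, homological and
numerical equivalence agree (only `p = q = 0` occurs, and `⟨x, x⟩ = 0` forces `x = 0` in
`H⁰(X) = K · 1`, `eq_zero_of_trace_cup_self_eq_zero`). [folklore] -/
theorem standardConjectureD_of_isSmoothProjective_zero (hX : IsSmoothProjective 0 X) :
    W.StandardConjectureD 0 X := by
  intro p q hpq x hx hnum
  obtain rfl : p = 0 := by omega
  obtain rfl : q = 0 := by omega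
  exact W.eq_zero_of_trace_cup_self_eq_zero hX x (hnum x hx)

/-- **`B ⇒ D` in the presence of `Hdg`** (one half of hodge.S29; Grothendieck 1968 §4,
Kleiman 1968 §3, Kleiman 1994 §5, Murre 2004 §4.2.1.4 (1)): if the Hodge standard conjecture
holds for `W`, then the standard conjecture of Lefschetz type for `W` (all `(X, η)`) implies
`D` for `W` (all `X`). In positive dimension apply
`standardConjectureD_of_standardConjectureB_of_standardConjectureHdg_self` to a hyperplane
class (`isHyperplaneClass_nonempty`); in dimension `0`,
`standardConjectureD_of_isSmoothProjective_zero`. [cite: Murre2004LecturesMotives, §4.2.1.4 (1)] -/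
theorem homNumStandardConjecture_of_lefschetzStandardConjecture
    (hHdg : W.HodgeStandardConjecture) (hB : W.LefschetzStandardConjecture) :
    W.HomNumStandardConjecture := by
  intro n X hX
  rcases Nat.eq_zero_or_pos n with rfl | hn
  · exact W.standardConjectureD_of_isSmoothProjective_zero hX
  · obtain ⟨η, hη⟩ := W.isHyperplaneClass_nonempty hX hn
    exact W.standardConjectureD_of_standardConjectureB_of_standardConjectureHdg_self hX hη
      (hB hX η hη) (hHdg hX η hη)

end WeilCohomology

/-! ## Reduction of the named fact to Kleiman's `D(X × X) ⇒ B(X)` -/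

section Reduction

variable {k : Type u} [Field k] {K : Type v} [Field K] [CharZero K] (W : WeilCohomology k K)

/-- **hodge.S29, `D ⇔ B` given `Hdg`, reduced to `D(X × X) ⇒ B(X)`** (Grothendieck 1968 §4;
Kleiman 1968 §3 with Thm 2.9; Kleiman 1994 §5). The named fact
`standardConjectureD_iff_standardConjectureB_of_hodgeStandardConjecture W` follows from
Kleiman's theorem `D(X × X) ⇒ B(X, η)` for all smooth projective `X` and hyperplane classes
`η` — the named fact `standardConjectureB_of_standardConjectureD_tensor` of
`StandardConjectures`, hypothesis `hDB` — together with the proved half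
`homNumStandardConjecture_of_lefschetzStandardConjecture` (`B ∧ Hdg ⇒ D`) and the smoothness
of `X × X` (`isSmoothProjective_tensor`). [cite: Kleiman1968AlgebraicCycles, §3 and Thm 2.9] -/
theorem standardConjectureD_iff_standardConjectureB_of_hodgeStandardConjecture_of
    (hDB : ∀ {n : ℕ} {X : SchemeOver k} {η : W.obj X 2},
      standardConjectureB_of_standardConjectureD_tensor (W := W) (n := n) (X := X) (η := η)) :
    standardConjectureD_iff_standardConjectureB_of_hodgeStandardConjecture W := by
  intro hL hHdg
  refine ⟨fun hD n X hX η hη ↦ hDB hL hX hη (hD (WeilCohomology.isSmoothProjective_tensor hX hX)),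
    fun hB ↦ W.homNumStandardConjecture_of_lefschetzStandardConjecture hHdg hB⟩

end Reduction

end Literature.AlgebraicGeometry.Motives

end
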